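import Mathlib

/-!
# Markman 2025 — LEMMA 9.1.4 (proof, the display after (9.1.2)) and LEMMA 9.3.1 (proof, p. 81 L45–64): translates of
# the theta divisor `Θ = D₁ ∪ D₂ ∪ D₃` of a CHAIN OF THREE ELLIPTIC CURVES — «the intersection of any four translates is
# empty» (pigeonhole on the three components) and «any three translates have finite intersection» (one point per
# permutation) — AS PRINTED, kernel-checked in the product model (9.1.2)

E. Markman: [M] *Cycles on abelian 2n-folds of Weil type from secant sheaves on abelian n-folds*,
arXiv:2502.03415 **v2** (2025-06-08), bib `Markman2025SecantWeil` — UNREFEREED PREPRINT. «p. N L m» = PyMuPDF line `m`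
of page `N` of the public v2 PDF (sha256/16 `8155aa33870069b8`), text layer re-extracted at seat lit-w-markman g21
(pub-hsemireg LIT-W, 2026-08-25; sheet `LOCATOR-SHEET-MARKMAN.md` §2 carries §9.3 verbatim; (9.1.2) and p. 81 L37–65 were
also read by eye on the renders `r_mar25v2_p71_L20-57.png`, `r_mar25v2_p81_L32-65.png` in
`HOME/lit/Markman-renders-litw-markman-g21/`). `EquivarianceGroupTranslationProjection.lean` (LEAN #33) proves the FIRST
sentence of Lemma 9.3.1's proof (Assumption 9.2.1 (2) ⟺ `G₁ ∩ G₂ = {0}`) and takes «everything geometric in Lemma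
9.3.1's proof after its first sentence» BY VALUE; this leaf kernel-checks the COMBINATORIAL part of that remainder — the
degenerate count on the chain of elliptic curves, which is also the mechanism of Lemma 9.1.4's proof — in the product
model that (9.1.2) prints (rows M-Mk6 of the LIT-W table: the genericity ASSUMPTION 9.2.1 (1) behind the one printed
semiregular `g = 6` object).

## What is printed (verbatim, v2)

* LEMMA 9.1.4, proof (p. 71 L26–57): «… it suffices to verify it for a boundary pair, where `C` is a chain `E₁ ∪ E₂ ∪ E₃`
  of three elliptic curves `E_i`, `1 ≤ i ≤ 3`. Let `G_i` be a cyclic group of order `d + 1` of `Pic⁰(E_i)`, and let `G` be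
  a diagonal embedding of `ℤ/(d + 1)ℤ` in `G₁ × G₂ × G₃ ⊂ Pic⁰(E₁) × Pic⁰(E₂) × Pic⁰(E₃) ≅ Pic⁰(C)`. … in this case
  `Θ = ∪_{i=1}^3 D_i`, where (9.1.2) `D₁ := {𝒪_{E₁}} × Pic²(E₂) × Pic⁰(E₃)`, `D₂ := Pic⁰(E₁) × {𝒪_{E₂}(p₀ + p₁)} × Pic⁰(E₃)`,
  `D₃ := Pic⁰(E₁) × Pic²(E₂) × {𝒪_{E₃}}`. Choose a generator `g` of `G`.
  `∩_{k=1}^{d+1} τ_{kg}(Θ) = ∪_{(i₀,…,i_d) ∈ {1,2,3}^{d+1}} ∩_{k=1}^{d+1} τ_{kg}(D_{i_k})`. Each intersection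
  `∩_{k=1}^{d+1} τ_{kg}(D_{i_k})` is empty, as `i_j = i_k` for some `j < k`, since `d + 1 > 3`, and `D_i ∩ τ_{kg}(D_i) = ∅`,
  for `0 < k < d + 1`, for all `i`.»
* ASSUMPTION 9.2.1 (1) (p. 72 L65–68): «We choose the curves `C_i` and `Σ_j`, so that the intersection of any four of the
  surfaces `Θ_{i,j} := Σ_j − C_i` in `X` is empty and the triple intersections are zero dimensional.»
* LEMMA 9.3.1 (p. 81 L32–36): «A generic `C` admits subgroups `G₁` and `G₂` of `Pic⁰(C)`, such that Assumption 9.2.1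
  holds for a `G₁` orbit `{C_i}_{i=1}^n` of translates of `C_p` and a `G₂` orbit `{Σ_i}_{i=1}^n` of translates of `Σ_p`.»
  Proof, p. 81 L39–64: «… it suffices to prove the existence of `G₁` and `G₂`, such that the intersection of any four
  translates `τ_{g₁+g₂}(Θ)`, `(g₁, g₂) ∈ G₁ × G₂`, is empty and any three translates have finite intersection. The
  property is open in moduli, and so it suffices to prove it for the degenerate case, where `C` is a chain of elliptic
  curves `E₁`, `E₂`, and `E₃`, as in the proof of Lemma 9.1.4. … Choose `G₁` and `G₂` so that `G₁ ∩ G₂ = {0}` and for each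
  `i` the restriction homomorphism `Pic⁰(C) → Pic⁰(E_i)` restricts to the subgroup `⟨G₁, G₂⟩` generated by `G₁` and `G₂`
  as an injective homomorphism. Each of the three irreducible components `D_i` of `Θ` is disjoint from its translate
  `τ_{g₁+g₂}(D_i)`, if `(g₁, g₂) ≠ (0, 0)`. Hence, the intersection of any four translates is empty and the intersection
  `τ_{g₁+g₂}(Θ) ∩ τ_{g′₁+g′₂}(Θ) ∩ τ_{g″₁+g″₂}(Θ)` of three translates is the union of
  `τ_{g₁+g₂}(D_i) ∩ τ_{g′₁+g′₂}(D_j) ∩ τ_{g″₁+g″₂}(D_k)`, with pairwise distinct `i, j, k`. Each of the latter intersections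
  consists of precisely one point. Hence, all triple intersections … are finite. □»

## The model and what is proved (0 `def`, 0 named fact, 0 sorry; nothing geometric beyond (9.1.2))

(9.1.2) literally: `Pic(C) ≅ ∏_i Pic(E_i)` is a product of copies of one set `A` (the `Pic(E_i)` are genus-one curves;
only their underlying sets enter) over a finite index type `ι` (`Fin 3`): a point is `x : ι → A`, the component `D_i`
translated to «level» `c` is the coordinate slice `{x | x i = c}`, and the translate of `Θ = ∪_i D_i` with corner
`t : ι → A` is `Θ_t := {x | ∃ i, x i = t i}` (`τ_g` moves the corner by `g`; §C). Translates with corners `t₁, …, t_m` are «in general position» when distinct ones differ in EVERY coordinate —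
which is what the printed injectivity device produces (§C: distinct elements of a subgroup `H = ⟨G₁, G₂⟩` on which
every coordinate projection is injective differ in every coordinate, `coord_ne_of_injOn`; «`D_i` is disjoint from its
translate … if `(g₁, g₂) ≠ (0, 0)`», `slice_disjoint_translate`; Lemma 9.1.4's diagonal generator: `diagonal_corners_general_position`,
`lemma914_degenerate_empty`). PROVED: §A the display of Lemma 9.1.4's proof —
`⋂_k Θ_{t_k} = ⋃_{(i_k)} ⋂_k D_{i_k}` (`iInter_theta_eq_iUnion`), each term with a repeated index EMPTY
(`iInter_slices_eq_empty_of_not_injective`), hence by pigeonhole «the intersection of any four translates is empty» /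
«since `d + 1 > 3`»: MORE THAN `#ι` translates in general position have empty intersection (`iInter_theta_eq_empty`,
Mathlib `Fintype.exists_ne_map_eq_of_card_lt`); §B «the intersection … of three translates is the union of
`τD_i ∩ τ′D_j ∩ τ″D_k`, with pairwise distinct `i, j, k`» (`iInter_theta_eq_iUnion_injective`), «Each of the latter
intersections consists of precisely one point» for `#ι` translates, i.e. for a bijective index choice
(`iInter_slices_bijective_eq_singleton`), «Hence, all triple intersections … are finite» (`iInter_theta_finite`).
BY VALUE / NOT formalised: that (9.1.2) IS the theta divisor of the chain, «The property is open in moduli» (the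
degeneration argument), `Θ_{i,j}` is a translate of `Θ`, Assumption 9.2.1 itself for the generic `C`, cyclicity/orders
of `G₁, G₂` (irrelevant to the count). Honest framing: bookkeeping of a printed elementary step; nothing here says that
Assumption 9.2.1 holds for any object of the pub-hsemireg cell, that any object is semiregular, or that HC ∕ HC_CM ∕ HC_AV
is proved; no theorem of [M] is re-proved beyond this combinatorics.
-/

namespace Literature.AlgebraicGeometry.Markman2025.ChainDegeneration

open Set

variable {ι : Type*} {A : Type*}

/-! ### §A — the display of LEMMA 9.1.4's proof and «the intersection of any four translates is empty» -/

/-- «`∩_{k} τ_k(Θ) = ∪_{(i_k) ∈ {1,2,3}^{m}} ∩_{k} τ_k(D_{i_k})`» — intersecting translates of `Θ = ∪_i D_i`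
distributes into the union over index choices `f : κ → ι` of the intersections of slices; `Θ` with corner `t` is
`{x | ∃ i, x i = t i}`, `D_i` at level `t i` is `{x | x i = t i}`.
[cite: Markman2025SecantWeil, Lemma 9.1.4 (proof, display after (9.1.2)), v2 p. 71 L44–54] -/
theorem iInter_theta_eq_iUnion {κ : Type*} (t : κ → ι → A) :
    (⋂ k, {x : ι → A | ∃ i, x i = t k i}) = ⋃ f : κ → ι, ⋂ k, {x : ι → A | x (f k) = t k (f k)} := by
  ext x
  simp only [mem_iInter, mem_setOf_eq, mem_iUnion]
  exact ⟨fun h => Classical.skolem.mp h, fun ⟨f, hf⟩ k => ⟨f k, hf k⟩⟩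

/-- «Each intersection `∩_k τ_{k}(D_{i_k})` is empty, as `i_j = i_k` for some `j < k` … and `D_i ∩ τ(D_i) = ∅`» — if
two DIFFERENT translates `j ≠ k` are assigned the SAME component `f j = f k` and their corners differ in that
coordinate, the intersection of slices is empty.
[cite: Markman2025SecantWeil, Lemma 9.1.4 (proof), v2 p. 71 L55–57; Lemma 9.3.1 (proof), p. 81 L47–49] -/
theorem iInter_slices_eq_empty_of_not_injective {κ : Type*} (t : κ → ι → A)
    (ht : ∀ j k, j ≠ k → ∀ i, t j i ≠ t k i) (f : κ → ι) (hf : ¬ Function.Injective f) :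
    (⋂ k, {x : ι → A | x (f k) = t k (f k)}) = ∅ := by
  obtain ⟨j, k, hfjk, hjk⟩ : ∃ j k, f j = f k ∧ j ≠ k := by
    simpa [Function.Injective, not_forall] using hf
  refine eq_empty_iff_forall_notMem.mpr fun x hx => ?_
  simp only [mem_iInter, mem_setOf_eq] at hx
  have h1 := hx j
  have h2 := hx k
  rw [hfjk] at h1
  exact ht j k hjk (f k) (h1.symm.trans h2)

/-- **«Hence, the intersection of any four translates is empty»** (Lemma 9.3.1, proof) ∕ **«since `d + 1 > 3`»**
(Lemma 9.1.4, proof): if there are MORE translates than components (`#ι < #κ`: `3 < 4`, `3 < d + 1`) and distinct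
translates differ in every coordinate, then `∩_k τ_k(Θ) = ∅` — every index choice `f : κ → ι` repeats an index
(pigeonhole, Mathlib `Fintype.exists_ne_map_eq_of_card_lt`).
[cite: Markman2025SecantWeil, Lemma 9.1.4 (proof), v2 p. 71 L44–57; Lemma 9.3.1 (proof), p. 81 L47–49] -/
theorem iInter_theta_eq_empty {κ : Type*} [Fintype κ] [Fintype ι] (hcard : Fintype.card ι < Fintype.card κ)
    (t : κ → ι → A) (ht : ∀ j k, j ≠ k → ∀ i, t j i ≠ t k i) :
    (⋂ k, {x : ι → A | ∃ i, x i = t k i}) = ∅ := by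
  rw [iInter_theta_eq_iUnion, iUnion_eq_empty]
  intro f
  refine iInter_slices_eq_empty_of_not_injective t ht f fun hf => ?_
  obtain ⟨j, k, hjk, hfjk⟩ := Fintype.exists_ne_map_eq_of_card_lt f hcard
  exact hjk (hf hfjk)

/-- The printed instance: FOUR translates of the theta divisor `D₁ ∪ D₂ ∪ D₃` of the chain of THREE elliptic curves,
in general position, have empty intersection. [cite: Markman2025SecantWeil, Lemma 9.3.1 (proof), v2 p. 81 L47–49] -/
theorem iInter_four_translates_eq_empty (t : Fin 4 → Fin 3 → A) (ht : ∀ j k, j ≠ k → ∀ i, t j i ≠ t k i) :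
    (⋂ k, {x : Fin 3 → A | ∃ i, x i = t k i}) = ∅ :=
  iInter_theta_eq_empty (by simp) t ht

/-- … and the instance of Lemma 9.1.4: the `d + 1 > 3` translates `τ_{kg}(Θ)`, `k = 1, …, d + 1`, in general position
have empty intersection. [cite: Markman2025SecantWeil, Lemma 9.1.4 (proof), v2 p. 71 L44–57] -/
theorem iInter_succ_translates_eq_empty {d : ℕ} (hd : 3 ≤ d) (t : Fin (d + 1) → Fin 3 → A)
    (ht : ∀ j k, j ≠ k → ∀ i, t j i ≠ t k i) : (⋂ k, {x : Fin 3 → A | ∃ i, x i = t k i}) = ∅ :=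
  iInter_theta_eq_empty (by simp; omega) t ht

/-! ### §B — three translates: «the union of `τD_i ∩ τ′D_j ∩ τ″D_k`, with pairwise distinct `i, j, k`», one point each -/

/-- «… the intersection `τ(Θ) ∩ τ′(Θ) ∩ τ″(Θ)` of three translates is the union of `τ(D_i) ∩ τ′(D_j) ∩ τ″(D_k)`, with
pairwise distinct `i, j, k`» — in general position only the INJECTIVE index choices contribute.
[cite: Markman2025SecantWeil, Lemma 9.3.1 (proof), v2 p. 81 L49–58] -/
theorem iInter_theta_eq_iUnion_injective {κ : Type*} (t : κ → ι → A) (ht : ∀ j k, j ≠ k → ∀ i, t j i ≠ t k i) :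
    (⋂ k, {x : ι → A | ∃ i, x i = t k i}) =
      ⋃ f : {f : κ → ι // Function.Injective f}, ⋂ k, {x : ι → A | x (f.1 k) = t k (f.1 k)} := by
  rw [iInter_theta_eq_iUnion]
  ext x
  simp only [mem_iUnion]
  constructor
  · rintro ⟨f, hf⟩
    by_cases hinj : Function.Injective f
    · exact ⟨⟨f, hinj⟩, hf⟩
    · rw [iInter_slices_eq_empty_of_not_injective t ht f hinj] at hf
      exact absurd hf (notMem_empty x)
  · rintro ⟨f, hf⟩
    exact ⟨f.1, hf⟩

/-- «Each of the latter intersections consists of precisely one point» — for as many translates as components and a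
BIJECTIVE index choice `f` (a permutation `(i, j, k)` of the three components), `τ₁(D_{f(1)}) ∩ τ₂(D_{f(2)}) ∩ τ₃(D_{f(3)})`
is the single point whose `i`-th coordinate is the `i`-th coordinate of the corner of the translate assigned to `i`.
[cite: Markman2025SecantWeil, Lemma 9.3.1 (proof), v2 p. 81 L58–59] -/
theorem iInter_slices_bijective_eq_singleton {κ : Type*} (t : κ → ι → A) (f : κ → ι)
    (hf : Function.Bijective f) :
    (⋂ k, {x : ι → A | x (f k) = t k (f k)}) = {fun i => t ((Equiv.ofBijective f hf).symm i) i} := by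
  set e := Equiv.ofBijective f hf with he
  have hef : ∀ k, e k = f k := fun k => rfl
  ext x
  simp only [mem_iInter, mem_setOf_eq, mem_singleton_iff]
  constructor
  · intro hx
    funext i
    have hk := hx (e.symm i)
    rwa [← hef, e.apply_symm_apply] at hk
  · rintro rfl k
    show t (e.symm (f k)) (f k) = t k (f k)
    rw [← hef, e.symm_apply_apply]

/-- «Hence, all triple intersections … are finite»: with as many translates as components (`#κ = #ι`, here `3 = 3`),
in general position, `∩_k τ_k(Θ)` is a finite union (over the injective = bijective index choices, at most `(#ι)!` of
them) of single points. [cite: Markman2025SecantWeil, Lemma 9.3.1 (proof), v2 p. 81 L49–64] -/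
theorem iInter_theta_finite {κ : Type*} [Fintype κ] [Fintype ι] (hcard : Fintype.card κ = Fintype.card ι)
    (t : κ → ι → A) (ht : ∀ j k, j ≠ k → ∀ i, t j i ≠ t k i) :
    (⋂ k, {x : ι → A | ∃ i, x i = t k i}).Finite := by
  rw [iInter_theta_eq_iUnion_injective t ht]
  refine finite_iUnion fun f => ?_
  have hbij : Function.Bijective f.1 :=
    (Fintype.bijective_iff_injective_and_card f.1).mpr ⟨f.2, hcard⟩
  rw [iInter_slices_bijective_eq_singleton t f.1 hbij]
  exact finite_singleton _

/-- The printed instance: THREE translates of `D₁ ∪ D₂ ∪ D₃` in general position meet in finitely many points (at most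
`3! = 6`: one for each ordering `(i, j, k)` of the components). [cite: Markman2025SecantWeil, Lemma 9.3.1 (proof), v2 p. 81 L49–64] -/
theorem iInter_three_translates_finite (t : Fin 3 → Fin 3 → A) (ht : ∀ j k, j ≠ k → ∀ i, t j i ≠ t k i) :
    (⋂ k, {x : Fin 3 → A | ∃ i, x i = t k i}).Finite :=
  iInter_theta_finite rfl t ht

/-! ### §C — translates and the injectivity device of p. 81 L45–48 -/

section Translates

variable [AddCommGroup A]

/-- `τ_g(D_i)`: translating the slice `{x | x i = c}` by `g ∈ ∏ Pic⁰(E_i)` gives the slice at level `c + g i`; so the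
translate of `Θ = ∪ D_i` with corner `p` by `g` is the one with corner `p + g`.
[cite: Markman2025SecantWeil, Lemma 9.1.4 (proof) with (9.1.2), v2 p. 71 L32–57] -/
theorem translate_slice (i : ι) (c : A) (g : ι → A) :
    (fun x : ι → A => x + g) '' {x | x i = c} = {x | x i = c + g i} := by
  ext x
  simp only [mem_image, mem_setOf_eq]
  constructor
  · rintro ⟨y, hy, rfl⟩
    simp [hy]
  · intro hx
    exact ⟨x - g, by simp [hx], by simp⟩

/-- «Each of the three irreducible components `D_i` of `Θ` is disjoint from its translate `τ_{g₁+g₂}(D_i), if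
(g₁, g₂) ≠ (0, 0)`» ∕ «`D_i ∩ τ_{kg}(D_i) = ∅`» — the slice at level `c` and its translate at level `c + g i` are
disjoint IFF `g i ≠ 0` (which the injectivity device below guarantees for `g ≠ 0`).
[cite: Markman2025SecantWeil, Lemma 9.3.1 (proof), v2 p. 81 L47–48; Lemma 9.1.4 (proof), p. 71 L57] -/
theorem slice_disjoint_translate (i : ι) (c : A) (g : ι → A) :
    Disjoint {x : ι → A | x i = c} {x | x i = c + g i} ↔ g i ≠ 0 := by
  rw [Set.disjoint_iff]
  constructor
  · intro h hgi
    have hmem : (fun _ : ι => c) ∈ {x : ι → A | x i = c} ∩ {x | x i = c + g i} :=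
      ⟨by simp, by simp [hgi]⟩
    exact h hmem
  · rintro hgi x ⟨h1, h2⟩
    rw [mem_setOf_eq] at h1 h2
    exact hgi (by simpa [h1] using h2.symm)

/-- The injectivity device: «Choose `G₁` and `G₂` so that … for each `i` the restriction homomorphism
`Pic⁰(C) → Pic⁰(E_i)` restricts to the subgroup `⟨G₁, G₂⟩` … as an injective homomorphism» ⟹ two DISTINCT elements of
`⟨G₁, G₂⟩` differ in EVERY coordinate — so distinct translates `τ_{g₁+g₂}(Θ)` are in general position (the hypothesis
`ht` of §A–§B), and a non-zero `g` has all `g i ≠ 0`.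
[cite: Markman2025SecantWeil, Lemma 9.3.1 (proof), v2 p. 81 L45–48] -/
theorem coord_ne_of_injOn (H : AddSubgroup (ι → A)) (hinj : ∀ i, Set.InjOn (fun g : ι → A => g i) H)
    {g g' : ι → A} (hg : g ∈ H) (hg' : g' ∈ H) (hne : g ≠ g') (i : ι) : g i ≠ g' i :=
  fun h => hne (hinj i hg hg' h)

/-- Consequently the corners `p + g_k` of the translates `τ_{g_k}(Θ)` by pairwise distinct `g_k ∈ ⟨G₁, G₂⟩` differ in
every coordinate — the general-position hypothesis `ht` of §A–§B, as produced in print.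
[cite: Markman2025SecantWeil, Lemma 9.3.1 (proof), v2 p. 81 L45–49] -/
theorem corners_general_position (H : AddSubgroup (ι → A)) (hinj : ∀ i, Set.InjOn (fun g : ι → A => g i) H)
    {κ : Type*} (p : ι → A) (g : κ → ι → A) (hg : ∀ k, g k ∈ H) (hdist : Function.Injective g) :
    ∀ j k, j ≠ k → ∀ i, (p + g j) i ≠ (p + g k) i := by
  intro j k hjk i h
  have h' : g j i = g k i := by simpa using h
  exact coord_ne_of_injOn H hinj (hg j) (hg k) (fun e => hjk (hdist e)) i h'

/-- Everything together, as printed for the chain: for `G₁, G₂ ≤ Pic⁰(C) = ∏ Pic⁰(E_i)` with every coordinate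
projection injective on `H = ⟨G₁, G₂⟩` (any subgroup `H` works), FOUR pairwise distinct elements of `H` give four
translates of `Θ` with EMPTY intersection and THREE give a FINITE intersection.
[cite: Markman2025SecantWeil, Lemma 9.3.1 (proof), v2 p. 81 L45–64] -/
theorem lemma931_degenerate_count (H : AddSubgroup (Fin 3 → A)) (hinj : ∀ i, Set.InjOn (fun g : Fin 3 → A => g i) H)
    (p : Fin 3 → A) :
    (∀ g : Fin 4 → Fin 3 → A, (∀ k, g k ∈ H) → Function.Injective g →
        (⋂ k, {x : Fin 3 → A | ∃ i, x i = (p + g k) i}) = ∅) ∧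
      (∀ g : Fin 3 → Fin 3 → A, (∀ k, g k ∈ H) → Function.Injective g →
        (⋂ k, {x : Fin 3 → A | ∃ i, x i = (p + g k) i}).Finite) :=
  ⟨fun g hg hdist => iInter_four_translates_eq_empty _ (corners_general_position H hinj p g hg hdist),
    fun g hg hdist => iInter_three_translates_finite _ (corners_general_position H hinj p g hg hdist)⟩

/-- LEMMA 9.1.4's own device: «let `G` be a diagonal embedding of `ℤ/(d + 1)ℤ` in `G₁ × G₂ × G₃`» with generator `g`
(every coordinate `g i` of order `n = d + 1`) — then the corners `p + k·g`, `k ∈ ℤ/n` (printed as `k = 1, …, d + 1`;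
`(d+1)g = 0`), differ in every coordinate for `k ≠ k′`, i.e. «`D_i ∩ τ_{kg}(D_i) = ∅`, for `0 < k < d + 1`, for all `i`»
(Mathlib `nsmul_injOn_Iio_addOrderOf`). [cite: Markman2025SecantWeil, Lemma 9.1.4 (proof), v2 p. 71 L28–30, L44, L57] -/
theorem diagonal_corners_general_position {n : ℕ} (p g : ι → A) (hg : ∀ i, addOrderOf (g i) = n) :
    ∀ j k : Fin n, j ≠ k → ∀ i, (p + (j : ℕ) • g) i ≠ (p + (k : ℕ) • g) i := by
  intro j k hjk i h
  have h' : (j : ℕ) • g i = (k : ℕ) • g i := by simpa using h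
  have hj : (j : ℕ) ∈ Set.Iio (addOrderOf (g i)) := by rw [hg]; exact j.2
  have hk : (k : ℕ) ∈ Set.Iio (addOrderOf (g i)) := by rw [hg]; exact k.2
  exact hjk (Fin.ext (nsmul_injOn_Iio_addOrderOf hj hk h'))

/-- LEMMA 9.1.4's emptiness, as printed for the chain: `d ≥ 3`, `g` a diagonal generator (each `g i` of order `d + 1`)
⟹ `∩_{k ∈ ℤ/(d+1)} τ_{kg}(Θ) = ∅`. [cite: Markman2025SecantWeil, Lemma 9.1.4 (proof), v2 p. 71 L24–57] -/
theorem lemma914_degenerate_empty {d : ℕ} (hd : 3 ≤ d) (p g : Fin 3 → A) (hg : ∀ i, addOrderOf (g i) = d + 1) :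
    (⋂ k : Fin (d + 1), {x : Fin 3 → A | ∃ i, x i = (p + (k : ℕ) • g) i}) = ∅ :=
  iInter_succ_translates_eq_empty hd _ (diagonal_corners_general_position p g hg)

end Translates

end Literature.AlgebraicGeometry.Markman2025.ChainDegeneration
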